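import Literature.AlgebraicGeometry.HodgeTheory.ChernCharacterLawsSupportedSheaves
import Literature.AlgebraicGeometry.HodgeTheory.ChernCharacterLawsSpanTopDegree
import Literature.AlgebraicGeometry.HodgeTheory.CycleClassPushforward
import HarnessLib

/-!
# The span law of a lawful non-degenerate Chern datum, reduced to ONE non-vanishing per subvariety

Family `hodge`, layer `Literature/AlgebraicGeometry/HodgeTheory`. HONEST FRAMING: nothing here constructs a Chern character or bears
on any case of the Hodge conjecture; `ChernCharacterBetti` stays a hypothesis structure without an instance. This file ASSEMBLES the
reductions of `HodgeTheory/ChernCharacterLawsCoherent` (span law ⟸ Gysin generators; `p > dim X` free),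
`HodgeTheory/ChernCharacterLawsSpanTopDegree` (top degree), `HodgeTheory/ChernCharacterLawsSupportedSheaves` (a Gysin generator `g_* 1_V`
lies in `ℂ · {ch_p(E)}` once ONE coherent sheaf supported on `g(V)` has `ch_p ≠ 0`) and `HodgeTheory/CycleClassPushforward`
(`g_* 1_V = 0` when `dim g(V) < dim V`, semipurity) into one statement:

* `ChernDatum.IsTopological.algebraicClasses_le_span_of_forall_exists_supported_ne_zero` — **for a datum `ch` with the nine topological
  laws and non-degenerate, the span law `Nᵖ H²ᵖ(X(ℂ); ℂ) ⊆ ℂ · {ch_p(E) : E a vector bundle}` holds on every smooth projective `X` in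
  every degree `p ≥ 1`, PROVIDED: for every smooth projective `X` of dimension `n`, every `1 ≤ p`, `1 ≤ d` with `d + p = n`, and every
  morphism `g : V ⟶ X` from a smooth projective `d`-fold whose generic point maps to a point of dimension `d` (i.e. `dim g(V) = d`),
  SOME coherent sheaf on `X` supported on `g(V)` has `ch_p ≠ 0`.**

In print the proviso is the leading term of Riemann–Roch for the (possibly singular) codimension-`p` subvariety `Z = g(V)`:
`c_p(𝒪_Z) = (−1)^{p−1}(p−1)! [Z] ≠ 0` (Fulton Example 15.3.5, from Thm. 15.2 ∕ §15.3 «Riemann–Roch without denominators»), equivalently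
`ch_p(𝒪_Z) = λᵖ [Z]` for a datum of scale `λ ≠ 0`. It is NOT proved here. Everything else is: no definition, no named fact, no
instance, no notation.

§2 (class form): `exists_eq_sum_smul_complexGysin_one_of_restrictCompl_eq_zero` (Deligne's shape for ANY class dying off
`⋃ gⱼ(Yⱼ)`), `complexGysin_one_mem_of_exists_restrictCompl_eq_zero_ne_zero`, and
`ChernDatum.IsTopological.algebraicClasses_le_span_of_forall_exists_class_ne_zero` — the span law ⟸ for every such `g`, ONE non-zero class
of `ℂ · {ch_p(E)}` dying off `g(V)` (for `p = 1`: `ch₁(𝒪_X(Z))` for a Cartier divisor with support `g(V)`).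

## References

* [Fulton1998] W. Fulton, Intersection Theory, 2nd ed. (1998): §1.4, Thm. 15.2, §15.3, Example 15.3.5, Example 15.2.16 (b), §19.1
  Lemma 19.1.1–19.1.2.
* [DeligneHodgeIII1974] P. Deligne, Théorie de Hodge III (1974): Cor. 8.2.8.
* [VoisinHodgeI2002] C. Voisin, Hodge Theory and Complex Algebraic Geometry I (2002): §11.1.2 Lemma 11.13, Thm. 11.32.
* [Grothendieck1958] A. Grothendieck, La théorie des classes de Chern (1958): Thm. 1.
* Tree: the four files named above.
-/

noncomputable section

open CategoryTheory CategoryTheory.Limits AlgebraicGeometry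
open Literature.AlgebraicTopology.SingularHomology
open Literature.AlgebraicGeometry.Motives Literature.AlgebraicGeometry.Modules Literature.AlgebraicGeometry.Morphisms
open Literature.AlgebraicGeometry.KTheory

namespace Literature.AlgebraicGeometry.HodgeTheory

namespace ChernDatum.IsTopological

section HodgeTheory

variable {ch : ChernDatum} {n : ℕ} {X : SchemeOver ℂ}

/-- **One Gysin generator**: for `g : V ⟶ X` from a smooth projective `d`-fold into the smooth projective `X` of dimension `d + p`,
the class `g_* 1_V` lies in `ℂ · {ch_p(E)}` as soon as EITHER the generic point of `V` maps to a point of dimension `< d` (then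
`g_* 1_V = 0`, semipurity) OR some coherent sheaf supported on `g(V)` has `ch_p ≠ 0` (Deligne's Gysin shape).
[cite: Fulton1998, §1.4 and Example 15.3.5] [cite: DeligneHodgeIII1974, Cor. 8.2.8] -/
theorem complexGysin_one_mem_span_ch_of_height (μ : OrientationFamily) (h : ch.IsTopological) (hX : IsSmoothProjective n X)
    {p d : ℕ} (hdp : d + p = n) {V : SchemeOver ℂ} (hV : IsSmoothProjective d V) (g : V ⟶ X) {η : V.left}
    (hη : IsGenericPoint η Set.univ)
    (H : (d : ℕ∞) ≤ Order.height (g.left.base η) → ∃ (F : X.left.Modules) (hF : Coh F),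
      (∀ W : X.left.Opens, Disjoint (W : Set X.left) (Set.range g.left.base) → IsZero ((Scheme.Modules.pullback W.ι).obj F)) ∧
        chKZeroCoh ch h.ch_shortExact hX p (KZeroCoh.of F hF) ≠ 0) :
    complexGysin μ hV hX g (a := 0) (b := 2 * p) (by omega) (singularCohomology.one ℂ (ComplexPoints V)) ∈
      Submodule.span ℂ {c | ∃ E : X.left.Modules, IsVectorBundle E ∧ ch X E p = c} := by
  by_cases hlt : Order.height (g.left.base η) < (d : ℕ∞)
  · rw [complexGysin_one_eq_zero_of_height_lt μ hV hX g hdp _ hη hlt]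
    exact Submodule.zero_mem _
  · obtain ⟨F, hF, h0, hne⟩ := H (not_lt.1 hlt)
    exact ChernDatum.complexGysin_one_mem_span_ch_of_range_eq_of_ne_zero ch h.ch_shortExact h.map_ch μ hX hdp hV g hF h0 hne

/-- **The span law of a lawful non-degenerate datum from one non-vanishing per subvariety.** Let `ch` satisfy the nine topological laws
and be non-degenerate. Suppose that for every smooth projective `X` of dimension `n`, every `1 ≤ p`, `1 ≤ d` with `d + p = n`, and every
`g : V ⟶ X` from a smooth projective `d`-fold whose generic point maps to a point of dimension `≥ d` (so `g(V)` is a codimension-`p`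
subvariety), some coherent sheaf on `X` supported on `g(V)` has `ch_p ≠ 0`. Then `Nᵖ H²ᵖ(X(ℂ); ℂ) ⊆ ℂ · {ch_p(E) : E a vector bundle}`
for every smooth projective `X` and every `p ≥ 1` — the middle degrees by `algebraicClasses_eq_span_complexGysin_one` and the previous
theorem, the top degree by `algebraicClasses_le_span_ch_of_degree_top`, the empty degrees by `algebraicClasses_le_span_of_dim_lt`.
[cite: Fulton1998, Example 15.2.16 (b), Example 15.3.5 and §19.1 Lemma 19.1.1] [cite: DeligneHodgeIII1974, Cor. 8.2.8]
[cite: VoisinHodgeI2002, Thm. 11.32] -/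
theorem algebraicClasses_le_span_of_forall_exists_supported_ne_zero (μ : OrientationFamily) (h : ch.IsTopological)
    (hnd : ch.NonDegenerate)
    (H : ∀ {n : ℕ} {X : SchemeOver ℂ} (hX : IsSmoothProjective n X) {p d : ℕ} (_ : 0 < p) (_ : 0 < d) (_ : d + p = n)
      (V : SchemeOver ℂ) (_ : IsSmoothProjective d V) (g : V ⟶ X) (η : V.left) (_ : IsGenericPoint η Set.univ)
      (_ : (d : ℕ∞) ≤ Order.height (g.left.base η)),
      ∃ (F : X.left.Modules) (hF : Coh F),
        (∀ W : X.left.Opens, Disjoint (W : Set X.left) (Set.range g.left.base) → IsZero ((Scheme.Modules.pullback W.ι).obj F)) ∧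
          chKZeroCoh ch h.ch_shortExact hX p (KZeroCoh.of F hF) ≠ 0)
    (hX : IsSmoothProjective n X) {p : ℕ} (hp : 0 < p) :
    algebraicClasses X p ≤ Submodule.span ℂ {c | ∃ E : X.left.Modules, IsVectorBundle E ∧ ch X E p = c} := by
  rcases lt_trichotomy p n with hpn | rfl | hpn
  · refine ChernDatum.algebraicClasses_le_span_of_forall_complexGysin_one_mem ch μ hX (d := n - p) (by omega) fun V hV g ↦ ?_
    haveI : IsIntegral V.left := IsSmoothProjective.isIntegral_holds hV
    exact h.complexGysin_one_mem_span_ch_of_height μ hX (by omega) hV g (genericPoint_spec V.left)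
      fun hle ↦ H hX hp (by omega) (by omega) V hV g (genericPoint V.left) (genericPoint_spec V.left) hle
  · exact h.algebraicClasses_le_span_ch_of_degree_top hnd hX hp
  · exact ChernDatum.algebraicClasses_le_span_of_dim_lt ch hX hpn

end HodgeTheory

end ChernDatum.IsTopological

/-! ### §2 The class form: one non-zero class of the span dying off the subvariety -/

section ClassForm

variable {n : ℕ} {X : SchemeOver ℂ}

/-- **Deligne's shape in the codimension, for an arbitrary class**: a class `x ∈ H²ᵖ(X(ℂ); ℂ)` dying off `Z = ⋃ⱼ gⱼ(Yⱼ)` (finitely many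
`gⱼ : Yⱼ ⟶ X` from smooth projective `Yⱼ` of dimension `d = n − p`) is `Σⱼ cⱼ • (gⱼ)_* 1_{Yⱼ}` for some scalars (Deligne, Hodge III,
Cor. 8.2.8 — the tree's theorem — with the degree bookkeeping and `H⁰(Yⱼ(ℂ); ℂ) = ℂ · 1`). [cite: DeligneHodgeIII1974, Cor. 8.2.8]
[cite: Fulton1998, §19.1 Lemma 19.1.1] -/
theorem exists_eq_sum_smul_complexGysin_one_of_restrictCompl_eq_zero (μ : OrientationFamily) (hX : IsSmoothProjective n X)
    {p d : ℕ} (hdp : d + p = n) {ι : Type} [Fintype ι] {Y : ι → SchemeOver ℂ} (hY : ∀ j, IsSmoothProjective d (Y j))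
    (g : ∀ j, Y j ⟶ X) {x : complexBetti X (2 * p)}
    (hx : complexBetti.restrictCompl X (⋃ j, Set.range (g j).left.base) (2 * p) x = 0) :
    ∃ c : ι → ℂ, x = ∑ j, c j • complexGysin μ (hY j) hX (g j) (a := 0) (b := 2 * p) (by omega)
      (singularCohomology.one ℂ (ComplexPoints (Y j))) := by
  have hker : x ∈ LinearMap.ker (complexBetti.restrictCompl X (⋃ j, Set.range (g j).left.base) (2 * p)).hom := hx
  rw [Deligne1974_ker_restrictCompl_eq_iSup_range_complexGysin_holds μ μ.hasPoincareDuality hX hY g (2 * p)] at hker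
  have hle : (⨆ (j : ι) (a : ℕ) (hab : a + 2 * n = 2 * p + 2 * d), LinearMap.range (complexGysin μ (hY j) hX (g j) hab)) ≤
      Submodule.span ℂ (Set.range fun j ↦
        complexGysin μ (hY j) hX (g j) (a := 0) (b := 2 * p) (by omega) (singularCohomology.one ℂ (ComplexPoints (Y j)))) := by
    refine iSup_le fun j ↦ iSup_le fun a ↦ iSup_le fun hab ↦ ?_
    obtain rfl : a = 0 := by omega
    rintro _ ⟨y, rfl⟩
    haveI := pathConnectedSpace_complexPoints_of_isSmoothProjective (hY j)
    rw [singularCohomology.eq_smul_one ℂ y, map_smul]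
    exact Submodule.smul_mem _ _ (Submodule.subset_span ⟨j, rfl⟩)
  obtain ⟨c, hc⟩ := (Submodule.mem_span_range_iff_exists_fun ℂ).1 (hle hker)
  exact ⟨c, hc.symm⟩

/-- **One map, arbitrary class**: a class dying off `g(Y)` (`g : Y ⟶ X`, `Y` smooth projective of dimension `n − p`) is `c • g_* 1_Y`.
[cite: DeligneHodgeIII1974, Cor. 8.2.8] -/
theorem exists_eq_smul_complexGysin_one_of_restrictCompl_eq_zero (μ : OrientationFamily) (hX : IsSmoothProjective n X) {p d : ℕ}
    (hdp : d + p = n) {Y : SchemeOver ℂ} (hY : IsSmoothProjective d Y) (g : Y ⟶ X) {x : complexBetti X (2 * p)}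
    (hx : complexBetti.restrictCompl X (Set.range g.left.base) (2 * p) x = 0) :
    ∃ c : ℂ, x = c • complexGysin μ hY hX g (a := 0) (b := 2 * p) (by omega) (singularCohomology.one ℂ (ComplexPoints Y)) := by
  have key : ∀ Z : Set X.left, Z = Set.range g.left.base → complexBetti.restrictCompl X Z (2 * p) x = 0 := by
    rintro Z rfl; exact hx
  obtain ⟨c, hc⟩ := exists_eq_sum_smul_complexGysin_one_of_restrictCompl_eq_zero μ hX hdp (ι := Unit) (Y := fun _ ↦ Y)
    (fun _ ↦ hY) (fun _ ↦ g) (x := x) (key _ (Set.iUnion_const _))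
  exact ⟨c (), by simpa only [Finset.univ_unique, Finset.sum_singleton] using hc⟩

/-- **A Gysin generator lies in a subspace as soon as the subspace contains ONE non-zero class dying off the image**: for `g : Y ⟶ X`
(`Y` smooth projective of dimension `n − p`) and a submodule `S ⊆ H²ᵖ(X(ℂ); ℂ)` containing some `x ≠ 0` with `x|_{(X ∖ g(Y))(ℂ)} = 0`,
`g_* 1_Y ∈ S` (`x = c • g_* 1_Y` with `c ≠ 0`). [cite: DeligneHodgeIII1974, Cor. 8.2.8] [cite: Fulton1998, Example 15.3.5] -/
theorem complexGysin_one_mem_of_exists_restrictCompl_eq_zero_ne_zero (μ : OrientationFamily) (hX : IsSmoothProjective n X)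
    {p d : ℕ} (hdp : d + p = n) {Y : SchemeOver ℂ} (hY : IsSmoothProjective d Y) (g : Y ⟶ X)
    (S : Submodule ℂ (complexBetti X (2 * p)))
    (H : ∃ x ∈ S, complexBetti.restrictCompl X (Set.range g.left.base) (2 * p) x = 0 ∧ x ≠ 0) :
    complexGysin μ hY hX g (a := 0) (b := 2 * p) (by omega) (singularCohomology.one ℂ (ComplexPoints Y)) ∈ S := by
  obtain ⟨x, hxS, hx0, hxne⟩ := H
  obtain ⟨c, hc⟩ := exists_eq_smul_complexGysin_one_of_restrictCompl_eq_zero μ hX hdp hY g hx0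
  have hc0 : c ≠ 0 := by
    rintro rfl
    exact hxne (by rw [hc, zero_smul])
  rw [hc] at hxS
  have h' := S.smul_mem c⁻¹ hxS
  rwa [smul_smul, inv_mul_cancel₀ hc0, one_smul] at h'

/-- **The span law of a lawful non-degenerate datum from one non-zero class per subvariety** (class form of
`algebraicClasses_le_span_of_forall_exists_supported_ne_zero`): it suffices that for every `g : V ⟶ X` from a smooth projective
`(n − p)`-fold whose generic point maps to a point of dimension `≥ n − p` (`1 ≤ p`, `1 ≤ n − p`), SOME non-zero class of
`ℂ · {ch_p(E) : E a vector bundle}` dies on `(X ∖ g(V))(ℂ)` — e.g. `ch_p` of a coherent sheaf supported on `g(V)`, or, for `p = 1`,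
`ch₁(𝒪_X(Z)) − ch₁(𝒪_X)` for a Cartier divisor with support `g(V)`. [cite: Fulton1998, Example 15.2.16 (b) and Example 15.3.5]
[cite: DeligneHodgeIII1974, Cor. 8.2.8] [cite: VoisinHodgeI2002, Thm. 11.32] -/
theorem ChernDatum.IsTopological.algebraicClasses_le_span_of_forall_exists_class_ne_zero (μ : OrientationFamily) {ch : ChernDatum}
    (h : ch.IsTopological) (hnd : ch.NonDegenerate)
    (H : ∀ {n : ℕ} {X : SchemeOver ℂ} (hX : IsSmoothProjective n X) {p d : ℕ} (_ : 0 < p) (_ : 0 < d) (_ : d + p = n)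
      (V : SchemeOver ℂ) (_ : IsSmoothProjective d V) (g : V ⟶ X) (η : V.left) (_ : IsGenericPoint η Set.univ)
      (_ : (d : ℕ∞) ≤ Order.height (g.left.base η)),
      ∃ x ∈ Submodule.span ℂ {c | ∃ E : X.left.Modules, IsVectorBundle E ∧ ch X E p = c},
        complexBetti.restrictCompl X (Set.range g.left.base) (2 * p) x = 0 ∧ x ≠ 0)
    {n : ℕ} {X : SchemeOver ℂ} (hX : IsSmoothProjective n X) {p : ℕ} (hp : 0 < p) :
    algebraicClasses X p ≤ Submodule.span ℂ {c | ∃ E : X.left.Modules, IsVectorBundle E ∧ ch X E p = c} := by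
  rcases lt_trichotomy p n with hpn | rfl | hpn
  · refine ChernDatum.algebraicClasses_le_span_of_forall_complexGysin_one_mem ch μ hX (d := n - p) (by omega) fun V hV g ↦ ?_
    haveI : IsIntegral V.left := IsSmoothProjective.isIntegral_holds hV
    by_cases hlt : Order.height (g.left.base (genericPoint V.left)) < ((n - p : ℕ) : ℕ∞)
    · rw [complexGysin_one_eq_zero_of_height_lt μ hV hX g (e := p) (by omega) _ (genericPoint_spec V.left) hlt]
      exact Submodule.zero_mem _
    · exact complexGysin_one_mem_of_exists_restrictCompl_eq_zero_ne_zero μ hX (by omega) hV g _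
        (H hX hp (by omega) (by omega) V hV g (genericPoint V.left) (genericPoint_spec V.left) (not_lt.1 hlt))
  · exact h.algebraicClasses_le_span_ch_of_degree_top hnd hX hp
  · exact ChernDatum.algebraicClasses_le_span_of_dim_lt ch hX hpn

end ClassForm

end Literature.AlgebraicGeometry.HodgeTheory

end
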